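import Literature.Topology.FourManifolds.KnotTubeRadial
import Literature.Topology.FourManifolds.BandGermAnalysis
import HarnessLib

/-!
# A knot crossing the tube of another knot: the crossing germ in tubular coordinates

Topic `Literature/Topology/FourManifolds` (trunk T-4MAN); fact seat
`provefact-Literature.Topology.FourManifolds.Knot.exists_isBandSum` (`BandSum.lean`: existence of
band sums, Gompf–Stipsicz (1999), §5.1).  The band between two knots `K₁`, `K₂` is written in the
tubular coordinates of an auxiliary embedded circle `E` (`E.tubularMap : 𝕊¹ × ℝ² → 𝕊³`,
`DehnSurgeryTubularNbhdProofs.lean`) which crosses `K₁` and `K₂` once each, transversally.  This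
file provides the two local ingredients of that formula, for a knot `K` and the auxiliary knot `E`:

* `Literature.Topology.FourManifolds.SphereEmbedding.exists_edgeGerm` — **the crossing germ in
  coordinates**: if `E (circlePoint φ₀) = K (circlePoint θ)` and the two velocities there are not
  parallel, then the arc `y ↦ K (circlePoint (θ + s y))` (`s = ±1`) is, for `|y| ≤ ε`,
  `E.tubularMap (circlePoint (φ₀ + φ y), w y)` for `C^∞` functions `φ : ℝ → ℝ`, `w : ℝ → ℝ²`
  defined on the whole line (globalised by a smooth clamp), with `φ 0 = 0`, `w 0 = 0`,
  `w' 0 ≠ 0` (transversality), `w` injective on `[-ε, ε]`, and `|φ|`, `‖w‖` bounded by any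
  prescribed `b > 0` (local inverse of the tubular map, `IsLocalDiffeomorphAt.localInverse`, and a
  smooth local angle `ang` on the circle);
* `Literature.Topology.FourManifolds.SphereEmbedding.exists_radius_tube_inter_range` — **thin
  tubes of `E` meet `K` only near the crossing**: if `range E ∩ range K ⊆ {K (circlePoint θ)}`
  then for every `τ > 0` some tube `‖w‖ < ρ` of `E` meets `K` only in points
  `K (circlePoint (θ + t))`, `|t| < τ` (the rest of `K` is a compact set off `range E`).

Everything here is proved; no definitions, no named facts.

## References

* M. W. Hirsch, *Differential Topology*, GTM 33 (1976), Ch. 4 §5 (tubular neighbourhoods),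
  Ch. 1 §3 (immersions and submersions in coordinates). [Hirsch1976]
* R. E. Gompf, A. I. Stipsicz, *4-Manifolds and Kirby Calculus*, GSM 20, AMS (1999), §5.1
  (the consumer). [GompfStipsicz1999]
-/

open scoped Manifold ContDiff Topology RealInnerProductSpace Real
open Function Set Filter Metric

noncomputable section

namespace Literature.Topology.FourManifolds

/-- Local notation: `𝔼 n` is the model Euclidean space `EuclideanSpace ℝ (Fin n)`. -/
local notation "𝔼 " n:arg => EuclideanSpace ℝ (Fin n)

/-- Local notation: `𝕊 n` is the unit sphere in `EuclideanSpace ℝ (Fin (n + 1))`. -/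
local notation "𝕊 " n:arg => (Metric.sphere (0 : EuclideanSpace ℝ (Fin (n + 1))) 1)

/-- Local notation: the model with corners of `𝕊¹ × ℝ²`. -/
local notation "𝓘₁₂" => (ModelWithCorners.prod (𝓡 1) 𝓘(ℝ, EuclideanSpace ℝ (Fin 2)))

attribute [local instance] fact_finrank_euclideanSpace_two fact_finrank_euclideanSpace_four

namespace SphereEmbedding

variable (E K : SphereEmbedding 1 3)

/-! ### Velocities of the squeezed tube on the zero section -/

/-- The `θ`-derivative of the squeezed tube map on the zero section is the velocity of the knot.
[folklore] -/
theorem fderiv_tubeδ_zero_fst (δ θ : ℝ) :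
    fderiv ℝ (E.tubeδ δ) (θ, 0) ((1 : ℝ), (0 : 𝔼 2)) = E.tangent θ := by
  rw [(E.hasFDerivAt_tubeδ δ θ 0).fderiv]
  simp only [ContinuousLinearMap.comp_apply, ContinuousLinearMap.prod_apply,
    ContinuousLinearMap.coe_fst', ContinuousLinearMap.coe_snd', map_zero, squeeze_zero]
  exact E.fderiv_tube_zero_fst θ

/-- A vector `(a, v)` of `ℝ × ℝ²` splits as `a • (1, 0) + (0, v)`. [folklore] -/
theorem prod_eq_smul_add (a : ℝ) (v : 𝔼 2) :
    ((a, v) : ℝ × 𝔼 2) = a • ((1 : ℝ), (0 : 𝔼 2)) + ((0 : ℝ), v) := by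
  ext <;> simp

/-! ### The crossing germ in tubular coordinates -/

/-- **The crossing germ of `K` in the tubular coordinates of `E`.**  Let `E (circlePoint φ₀) =
K (circlePoint θ)` with non-parallel velocities, let `s = ±1`, and let `ang` be a local angle on
the circle, smooth on an open set `A ∋ circlePoint φ₀`, with `circlePoint (ang u) = u` and
`ang (circlePoint φ₀) = φ₀`.  Then for every `b > 0` there are `ε > 0` and `C^∞` functions
`φ : ℝ → ℝ`, `w : ℝ → ℝ²` with `φ 0 = 0`, `w 0 = 0`, `deriv w 0 ≠ 0`, `w` injective on
`[-ε, ε]`, `|φ| ≤ b`, `‖w‖ ≤ b`, and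
`E.tubularMap (circlePoint (φ₀ + φ y), w y) = K (circlePoint (θ + s y))` for `|y| ≤ ε`.
Hirsch (1976), Ch. 4 §5 with Ch. 1 §3. [cite: Hirsch1976, §4.5] -/
theorem exists_edgeGerm {φ₀ θ s : ℝ} (hs : s = 1 ∨ s = -1)
    (hpt : E (circlePoint φ₀) = K (circlePoint θ))
    (htr : ∀ c : ℝ, K.tangent θ ≠ c • E.tangent φ₀)
    (ang : 𝕊 1 → ℝ) {A : Set (𝕊 1)} (hA : IsOpen A) (hφ₀A : circlePoint φ₀ ∈ A)
    (hang₁ : ∀ u, circlePoint (ang u) = u)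
    (hang₂ : ∀ u ∈ A, ContMDiffAt (𝓡 1) 𝓘(ℝ, ℝ) ∞ ang u) (hang₃ : ang (circlePoint φ₀) = φ₀)
    {b : ℝ} (hb : 0 < b) :
    ∃ ε > 0, ∃ (φ : ℝ → ℝ) (w : ℝ → 𝔼 2), ContDiff ℝ ∞ φ ∧ ContDiff ℝ ∞ w ∧ φ 0 = 0 ∧ w 0 = 0 ∧
      deriv w 0 ≠ 0 ∧ InjOn w (Icc (-ε) ε) ∧ (∀ y, |φ y| ≤ b) ∧ (∀ y, ‖w y‖ ≤ b) ∧
      ∀ y, |y| ≤ ε → E.tubularMap (circlePoint (φ₀ + φ y), w y) = K (circlePoint (θ + s * y)) := by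
  have hn : (∞ : WithTop ℕ∞) ≠ 0 := by simp
  set R := E.tubularRadius with hR
  -- ### the local inverse of the tubular map at the crossing
  have hL := E.isLocalDiffeomorph_tubularMap (circlePoint φ₀, 0)
  set L := hL.localInverse with hLdef
  set S : Set (𝕊 3) := L.source with hSdef
  have hSo : IsOpen S := hL.localInverse_open_source
  have hTS : E.tubularMap (circlePoint φ₀, 0) ∈ S := hL.localInverse_mem_source
  have hKS : K (circlePoint θ) ∈ S := by rwa [tubularMap_zero, hpt] at hTS
  -- the arc of `K` through the crossing
  set k : ℝ → 𝕊 3 := fun y ↦ K (circlePoint (θ + s * y)) with hk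
  have hks : ContMDiff 𝓘(ℝ, ℝ) (𝓡 3) ∞ k :=
    (K.contMDiff.comp contMDiff_circlePoint).comp
      ((contDiff_const.add (contDiff_const.mul contDiff_id)).contMDiff)
  have hk0 : k 0 = K (circlePoint θ) := by simp [hk]
  set Y : Set ℝ := k ⁻¹' S with hY
  have hYo : IsOpen Y := hSo.preimage hks.continuous
  have h0Y : (0 : ℝ) ∈ Y := by change k 0 ∈ S; rwa [hk0]
  -- the germ in coordinates
  set c : ℝ → (𝕊 1) × 𝔼 2 := fun y ↦ L (k y) with hc
  have hTc : ∀ y ∈ Y, E.tubularMap (c y) = k y := fun y hy ↦ hL.localInverse_right_inv hy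
  have hc0 : c 0 = (circlePoint φ₀, 0) := by
    change L (k 0) = (circlePoint φ₀, 0)
    rw [hk0, ← hpt, ← E.tubularMap_zero (circlePoint φ₀)]
    exact hL.localInverse_left_inv hL.localInverse_mem_target
  have hcs : ∀ y ∈ Y, ContMDiffAt 𝓘(ℝ, ℝ) 𝓘₁₂ ∞ c y := fun y hy ↦
    (hL.localInverse_contMDiffOn.contMDiffAt (hSo.mem_nhds hy)).comp y (hks y)
  set u : ℝ → 𝕊 1 := fun y ↦ (c y).1 with hu
  set wv : ℝ → 𝔼 2 := fun y ↦ (c y).2 with hwv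
  set φr : ℝ → ℝ := fun y ↦ ang (u y) - φ₀ with hφr
  have hu0 : u 0 = circlePoint φ₀ := by simp [hu, hc0]
  have hwv0 : wv 0 = 0 := by simp [hwv, hc0]
  have hφr0 : φr 0 = 0 := by simp [hφr, hu0, hang₃]
  have hcp : ∀ y, circlePoint (φ₀ + φr y) = u y := fun y ↦ by
    simp only [hφr, add_sub_cancel]
    exact hang₁ (u y)
  -- the domain of smoothness
  have huc : ContinuousOn u Y := fun y hy ↦ ((hcs y hy).continuousAt.fst).continuousWithinAt
  set D : Set ℝ := Y ∩ u ⁻¹' A with hD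
  have hDo : IsOpen D := huc.isOpen_inter_preimage hYo hA
  have h0D : (0 : ℝ) ∈ D := ⟨h0Y, by change u 0 ∈ A; rwa [hu0]⟩
  have hwvs : ∀ y ∈ D, ContDiffAt ℝ ∞ wv y := fun y hy ↦
    contMDiffAt_iff_contDiffAt.1 (hcs y hy.1).snd
  have hφrs : ∀ y ∈ D, ContDiffAt ℝ ∞ φr y := fun y hy ↦ by
    have h1 : ContMDiffAt 𝓘(ℝ, ℝ) 𝓘(ℝ, ℝ) ∞ (fun y ↦ ang (u y)) y :=
      (hang₂ (u y) hy.2).comp y (hcs y hy.1).fst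
    exact (contMDiffAt_iff_contDiffAt.1 h1).sub contDiffAt_const
  -- ### transversality: `wv' 0 ≠ 0`
  have hwvd : deriv wv 0 ≠ 0 := by
    intro hzero
    -- the arc read in `ℝ⁴` through the coordinates
    have hcoe : ∀ y ∈ Y, K.curve (θ + s * y) = E.tubeδ R (φ₀ + φr y, wv y) := fun y hy ↦ by
      rw [curve_apply, ← E.coe_tubularMap_circlePoint, hcp]
      change _ = ((E.tubularMap (c y) : 𝕊 3) : 𝔼 4)
      rw [hTc y hy]
    have hev : (fun y ↦ K.curve (θ + s * y)) =ᶠ[𝓝 0] fun y ↦ E.tubeδ R (φ₀ + φr y, wv y) :=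
      Filter.eventuallyEq_of_mem (hYo.mem_nhds h0Y) hcoe
    -- left-hand side: velocity `s • K'(θ)`
    have hlhs : HasDerivAt (fun y ↦ K.curve (θ + s * y)) (s • K.tangent θ) 0 := by
      have h1 : HasDerivAt (fun y : ℝ ↦ θ + s * y) s 0 := by
        simpa using ((hasDerivAt_id (0 : ℝ)).const_mul s).const_add θ
      have h2 : HasDerivAt (K.curve ∘ fun y ↦ θ + s * y) (s • K.tangent (θ + s * 0)) 0 :=
        (K.hasDerivAt_curve (θ + s * 0)).scomp 0 h1
      rw [mul_zero, add_zero] at h2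
      exact h2
    -- right-hand side: through the differential of the squeezed tube at `(φ₀, 0)`
    have hφd : HasDerivAt φr (deriv φr 0) 0 :=
      ((hφrs 0 h0D).differentiableAt (by simp)).hasDerivAt
    have hwd : HasDerivAt wv (deriv wv 0) 0 :=
      ((hwvs 0 h0D).differentiableAt (by simp)).hasDerivAt
    have hpair : HasDerivAt (fun y ↦ ((φ₀ + φr y, wv y) : ℝ × 𝔼 2)) (deriv φr 0, deriv wv 0) 0 := by
      have := (hφd.const_add φ₀).prodMk hwd
      simpa using this
    have hrhs : HasDerivAt (fun y ↦ E.tubeδ R (φ₀ + φr y, wv y))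
        (fderiv ℝ (E.tubeδ R) (φ₀, 0) (deriv φr 0, deriv wv 0)) 0 := by
      have h := ((E.differentiable_tubeδ R) (φ₀ + φr 0, wv 0)).hasFDerivAt.comp_hasDerivAt 0 hpair
      rw [hφr0, add_zero, hwv0] at h
      exact h
    have heq : s • K.tangent θ = fderiv ℝ (E.tubeδ R) (φ₀, 0) (deriv φr 0, deriv wv 0) :=
      hlhs.unique (hrhs.congr_of_eventuallyEq hev)
    rw [hzero, prod_eq_smul_add (deriv φr 0) (0 : 𝔼 2), map_add, map_smul,
      fderiv_tubeδ_zero_fst] at heq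
    have hz : fderiv ℝ (E.tubeδ R) (φ₀, 0) ((0 : ℝ), (0 : 𝔼 2)) = 0 := by
      rw [show ((0 : ℝ), (0 : 𝔼 2)) = (0 : ℝ × 𝔼 2) from rfl, map_zero]
    rw [hz, add_zero] at heq
    have hs2 : s * s = 1 := by rcases hs with rfl | rfl <;> norm_num
    apply htr (s * deriv φr 0)
    calc K.tangent θ = s • (s • K.tangent θ) := by rw [smul_smul, hs2, one_smul]
      _ = (s * deriv φr 0) • E.tangent φ₀ := by rw [heq, smul_smul]
  -- ### local injectivity of `wv`
  have hstrict : HasStrictFDerivAt wv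
      (ContinuousLinearMap.smulRight (1 : ℝ →L[ℝ] ℝ) (deriv wv 0)) 0 :=
    ((hwvs 0 h0D).hasStrictDerivAt (by simp)).hasStrictFDerivAt
  have hinjd : Injective (ContinuousLinearMap.smulRight (1 : ℝ →L[ℝ] ℝ) (deriv wv 0)) := by
    intro a a' h
    have : a • deriv wv 0 = a' • deriv wv 0 := by simpa using h
    exact smul_left_injective ℝ hwvd this
  obtain ⟨N, hN, hNinj⟩ := exists_mem_nhds_injOn_of_hasStrictFDerivAt hstrict hinjd
  -- ### smallness
  have hφrc : ContinuousAt φr 0 := (hφrs 0 h0D).continuousAt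
  have hwvc : ContinuousAt wv 0 := (hwvs 0 h0D).continuousAt
  have hsmall : ∀ᶠ y in 𝓝 (0 : ℝ), |φr y| < b ∧ ‖wv y‖ < b := by
    have h1 : ∀ᶠ y in 𝓝 (0 : ℝ), |φr y| < b := by
      have := hφrc.preimage_mem_nhds (Metric.ball_mem_nhds (φr 0) hb)
      filter_upwards [this] with y hy
      simpa [Real.dist_eq, hφr0] using hy
    have h2 : ∀ᶠ y in 𝓝 (0 : ℝ), ‖wv y‖ < b := by
      have := hwvc.preimage_mem_nhds (Metric.ball_mem_nhds (wv 0) hb)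
      filter_upwards [this] with y hy
      simpa [dist_eq_norm, hwv0] using hy
    exact h1.and h2
  -- ### the radius `ε`: `[-2ε, 2ε]` inside `D`, inside `N`, and small
  obtain ⟨ε, hε, hεall⟩ : ∃ ε > 0, ∀ y : ℝ, |y| ≤ 2 * ε → y ∈ D ∧ y ∈ N ∧ |φr y| < b ∧ ‖wv y‖ < b := by
    have hev : ∀ᶠ y in 𝓝 (0 : ℝ), y ∈ D ∧ y ∈ N ∧ |φr y| < b ∧ ‖wv y‖ < b := by
      filter_upwards [hDo.mem_nhds h0D, hN, hsmall] with y h1 h2 h3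
      exact ⟨h1, h2, h3⟩
    obtain ⟨r, hr, hball⟩ := Metric.eventually_nhds_iff_ball.1 hev
    refine ⟨r / 4, by positivity, fun y hy ↦ hball y ?_⟩
    rw [Metric.mem_ball, Real.dist_eq, sub_zero]
    linarith
  -- ### globalise by the clamp
  obtain ⟨cl, hcls, hclid, hclb⟩ := exists_smooth_clamp hε
  have hclD : ∀ y, cl y ∈ D := fun y ↦ (hεall (cl y) (hclb y)).1
  have hcl0 : cl 0 = 0 := hclid 0 (by simp [hε.le])
  refine ⟨ε, hε, fun y ↦ φr (cl y), fun y ↦ wv (cl y), ?_, ?_, ?_, ?_, ?_, ?_, ?_, ?_, ?_⟩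
  · exact contDiff_iff_contDiffAt.2 fun y ↦ (hφrs _ (hclD y)).comp y hcls.contDiffAt
  · exact contDiff_iff_contDiffAt.2 fun y ↦ (hwvs _ (hclD y)).comp y hcls.contDiffAt
  · simp only [hcl0, hφr0]
  · simp only [hcl0, hwv0]
  · -- the clamp is the identity near `0`, so the derivative is that of `wv`
    have hev : (fun y ↦ wv (cl y)) =ᶠ[𝓝 0] wv := by
      have ho : IsOpen {y : ℝ | |y| < ε} := isOpen_lt continuous_abs continuous_const
      filter_upwards [ho.mem_nhds (by simpa using hε)] with y hy
      rw [hclid y (le_of_lt hy)]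
    rw [hev.deriv_eq]
    exact hwvd
  · intro y hy y' hy' h
    have hya : |y| ≤ ε := abs_le.2 ⟨hy.1, hy.2⟩
    have hya' : |y'| ≤ ε := abs_le.2 ⟨hy'.1, hy'.2⟩
    have h' : wv (cl y) = wv (cl y') := h
    rw [hclid y hya, hclid y' hya'] at h'
    exact hNinj (hεall y (by linarith [abs_nonneg y])).2.1
      (hεall y' (by linarith [abs_nonneg y'])).2.1 h'
  · exact fun y ↦ (hεall (cl y) (hclb y)).2.2.1.le
  · exact fun y ↦ (hεall (cl y) (hclb y)).2.2.2.le
  · intro y hy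
    change E.tubularMap (circlePoint (φ₀ + φr (cl y)), wv (cl y)) = k y
    rw [hclid y hy, hcp]
    change E.tubularMap (c y) = k y
    exact hTc y (hεall y (by linarith [abs_nonneg y])).1.1

/-! ### Thin tubes of `E` meet `K` only near the crossing -/

/-- **A thin tube about `E` meets `K` only near the crossing point.**  If `range E ∩ range K ⊆
{K (circlePoint θ)}`, then for every `τ > 0` (with `τ ≤ π`) there is `ρ > 0` such that every
point `E.tubularMap (u, w)`, `‖w‖ < ρ`, lying on `K` is `K (circlePoint (θ + t))` for some
`|t| < τ`: the compact arc `K (circlePoint [θ + τ, θ + 2π - τ])` misses `range E`, hence a thin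
tube about it (`exists_forall_tubularMap_mem`). [folklore] -/
theorem exists_radius_tube_inter_range {θ : ℝ} (hEK : range E ∩ range K ⊆ {K (circlePoint θ)})
    {τ : ℝ} (hτ : 0 < τ) (hτπ : τ ≤ π) :
    ∃ ρ > 0, ∀ (u : 𝕊 1) (w : 𝔼 2), ‖w‖ < ρ → E.tubularMap (u, w) ∈ range K →
      ∃ t : ℝ, |t| < τ ∧ E.tubularMap (u, w) = K (circlePoint (θ + t)) := by
  -- the far arc of `K` is compact and misses `range E`
  set Afar : Set (𝕊 3) := (fun x : ℝ ↦ K (circlePoint x)) '' Icc (θ + τ) (θ + 2 * π - τ) with hAfar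
  have hAc : IsCompact Afar :=
    isCompact_Icc.image (K.continuous.comp continuous_circlePoint)
  have hAE : Disjoint Afar (range E) := by
    rw [Set.disjoint_left]
    rintro _ ⟨x, hx, rfl⟩ hxE
    have hmem : K (circlePoint x) ∈ range E ∩ range K := ⟨hxE, ⟨circlePoint x, rfl⟩⟩
    have heq : K (circlePoint x) = K (circlePoint θ) := hEK hmem
    obtain ⟨m, hm⟩ := exists_eq_add_of_circlePoint_eq (K.injective heq)
    -- `x = θ + m 2π` with `x ∈ [θ + τ, θ + 2π - τ]` is impossible
    have h1 : θ + τ ≤ θ + m * (2 * π) := hm ▸ hx.1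
    have h2 : θ + m * (2 * π) ≤ θ + 2 * π - τ := hm ▸ hx.2
    have hπ := Real.pi_pos
    have hm0 : (0 : ℝ) < m := by
      by_contra h
      push Not at h
      nlinarith
    have hm1 : (m : ℝ) < 1 := by
      by_contra h
      push Not at h
      nlinarith
    have hm0' : (0 : ℤ) < m := by exact_mod_cast hm0
    have hm1' : m < (1 : ℤ) := by exact_mod_cast hm1
    omega
  obtain ⟨ρ, hρ, hρV⟩ := E.exists_forall_tubularMap_mem hAc.isClosed.isOpen_compl
    (subset_compl_iff_disjoint_left.2 hAE)
  refine ⟨ρ, hρ, fun u w hw hmem ↦ ?_⟩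
  obtain ⟨z, hz⟩ := hmem
  obtain ⟨x₀, rfl⟩ := circlePoint_surjective z
  -- reduce the angle to `[θ - π, θ + π)`
  set x : ℝ := toIcoMod Real.two_pi_pos (θ - π) x₀ with hxdef
  have hxmem : x ∈ Ico (θ - π) (θ - π + 2 * π) := toIcoMod_mem_Ico _ _ _
  have hcp : circlePoint x = circlePoint x₀ := by
    rw [hxdef, toIcoMod]
    exact periodic_circlePoint.sub_zsmul_eq _
  refine ⟨x - θ, ?_, by rw [add_sub_cancel, hcp, hz]⟩
  -- if `|x - θ| ≥ τ` the point lies on the far arc, which misses the tube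
  by_contra hge
  rw [not_lt] at hge
  have hfar : E.tubularMap (u, w) ∈ Afar := by
    rw [← hz, ← hcp]
    rcases le_abs'.1 hge with h | h
    · -- `x - θ ≤ -τ`: use the angle `x + 2π`
      refine ⟨x + 2 * π, ⟨by linarith [hxmem.1], by linarith⟩, ?_⟩
      change K (circlePoint (x + 2 * π)) = K (circlePoint x)
      rw [circlePoint_add_two_pi]
    · exact ⟨x, ⟨by linarith, by linarith [hxmem.2]⟩, rfl⟩
  exact hρV u w hw hfar

end SphereEmbedding

end Literature.Topology.FourManifolds
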